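import Literature.AlgebraicGeometry.Resolution.BlowupStrictTransform
import Literature.AlgebraicGeometry.Resolution.BlowupChartPair
import HarnessLib

/-!
# The blow-up along an ideal locally generated by a regular pair: the two charts

Topic: `Literature/AlgebraicGeometry/Resolution`. Theorem-only file (sorry-free, no named fact).
Let `π : X' → X` be a blowing up (universal property, `IsBlowup π I`, `Blowups.lean`) and
`W ⊆ X` an affine open on which `I(W) = (u, v)` with `(u, v)` a **regular pair** of
`A = Γ(X, W)` (`u` a nonzerodivisor, `v` a nonzerodivisor modulo `u`). This is the local
situation of the blow-up of a regular scheme along a regular centre of codimension `2`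
(Hartshorne II Thm. 8.24; Fulton, *Intersection Theory*, proof of Lemma 2.4, p. 37: "`X̃ ⊂ X × ℙ¹`
is defined by `a'S = aT`") and of Shioda–Katsura's blow-up of `Xʳ⁺¹ₘ × X¹ₘ` along `Xʳₘ × X⁰ₘ`
(Tôhoku Math. J. 31 (1979), §1 (1.4)–(1.6)). Over `W` the blow-up is covered by the two
principal charts `X'[W, u]`, `X'[W, v]` (`BlowupPrincipalCharts.lean`), and we prove:

* `ringEquiv_quotient_blowupAlgebra_pair` — the affine blowup algebra of a regular pair:
  `A[X]/(uX - v) ≅ A[(u,v)/u]` (`x̄ ↦ v/u`; Stacks 0BIQ, from `BlowupChartPair.ker_chartEval`);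
* `IsBlowup.exists_ringEquiv_blowupChart_pair` — **the chart `X'[W, u]` is
  `Spec A[X]/(uX - v)` over `W`**: a ring isomorphism `Γ(X', X'[W, u]) ≅ A[X]/(uX - v)` under which
  `π^* : A → Γ(X', X'[W, u])` is the structure map, together with the regular function
  `T = π^*v / π^*u` (the image of `X`) with `π^*v = π^*u · T`;
* `IsBlowup.blowupChart_sup_blowupChart_pair` — `X'[W, u] ∪ X'[W, v] = π⁻¹(W)` (Stacks 0804);
* `exists_ringEquiv_quotient_of_ringEquiv_pair` — **the exceptional divisor and its base
  changes are affine lines**: for every ideal `K ⊇ (u, v)` of `A`,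
  `Γ(X', X'[W, u]) / K·Γ ≅ (A/K)[X]`, `π^*a ↦ ā`, `T ↦ X` (Liu, Thm. 8.1.19 (b): the
  exceptional divisor of the blow-up along a regular centre is a projective bundle over it — here
  its two affine pieces `𝔸¹ × V(u, v)`);
* `IsBlowup.basicOpen_le_blowupChart_pair` — `D(T) ⊆ X'[W, v]`;
* `IsBlowup.eq_of_notMem_basicOpen_pair` — `π` is injective on `X'[W, u] ∖ D(T)` (the strict
  transform of `V(v)`; Fulton, loc. cit.: "`C'` maps isomorphically by `π`");
* `IsBlowup.notMem_blowupChart_of_app_eq_zero` — a lift `λ : Y → X'` along which `v` pulls back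
  to `0` (and `(λ ≫ π)⁻¹ I · 𝒪_Y` is an effective Cartier divisor) misses `X'[W, v]`
  (Shioda–Katsura's section `Xʳₘ × X⁰ₘ → E`, Thm. 1.7, lands in the `u`-charts).

## References

* W. Fulton, *Intersection Theory*, 2nd ed. (1998), proof of Lemma 2.4 (p. 37). [Fulton1998]
* R. Hartshorne, *Algebraic Geometry* (1977), II Thm. 8.24. [Hartshorne1977]
* Q. Liu, *Algebraic Geometry and Arithmetic Curves* (2002), Thm. 8.1.19 (b). [Liu2002]
* T. Shioda, T. Katsura, On Fermat varieties, Tôhoku Math. J. 31 (1979), §1 (1.4)–(1.6),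
  Thm. 1.7. [ShiodaKatsura1979]
* The Stacks Project, Tags 0804, 0BIQ. [StacksProject]
-/

noncomputable section

open CategoryTheory CategoryTheory.Limits AlgebraicGeometry TopologicalSpace Opposite Polynomial

namespace Literature.AlgebraicGeometry.Resolution

universe u

/-! ## Algebra: the affine blowup algebra of a regular pair -/

section Algebra

variable {A : Type u} [CommRing A]

/-- The image of the relation ideal `(uX - v)` dies in `A[(u,v)/u] ⊆ A[1/u]`; the induced map
`A[X]/(uX - v) → A[(u, v)/u]`, `X ↦ v/u`. [cite: StacksProject, Tag 0BIQ] -/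
theorem eval₂_mem_blowupAlgebra_pair (u v : A) (p : A[X]) :
    Polynomial.eval₂ (algebraMap A (Localization.Away u))
      (algebraMap A (Localization.Away u) v * IsLocalization.Away.invSelf u) p ∈
        blowupAlgebra (Ideal.span {u, v}) u := by
  induction p using Polynomial.induction_on with
  | C a =>
    rw [Polynomial.eval₂_C]
    exact Subalgebra.algebraMap_mem _ a
  | add p q hp hq =>
    rw [Polynomial.eval₂_add]
    exact Subalgebra.add_mem _ hp hq
  | monomial n a _ =>
    rw [Polynomial.eval₂_mul, Polynomial.eval₂_C, Polynomial.eval₂_X_pow]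
    refine Subalgebra.mul_mem _ (Subalgebra.algebraMap_mem _ a) (Subalgebra.pow_mem _ ?_ _)
    exact div_mem_blowupAlgebra _ _ (Ideal.subset_span (by simp))

/-- `BlowupChartPair.chartEval u v` is `eval₂ (algebraMap) (v/u)`. [folklore] -/
theorem chartEval_eq_eval₂ (u v : A) (p : A[X]) :
    BlowupChartPair.chartEval u v p = Polynomial.eval₂ (algebraMap A (Localization.Away u))
      (algebraMap A (Localization.Away u) v * IsLocalization.Away.invSelf u) p := by
  have hx : IsLocalization.mk' (Localization.Away u) v
      (⟨u, Submonoid.mem_powers u⟩ : Submonoid.powers u) =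
      algebraMap A (Localization.Away u) v * IsLocalization.Away.invSelf u := by
    rw [IsLocalization.Away.invSelf, ← IsLocalization.mk'_eq_mul_mk'_one]
  change Polynomial.aeval _ p = _
  rw [Polynomial.aeval_def, hx]

/-- **The affine blowup algebra of a regular pair is `A[X]/(uX - v)`** (Stacks 0BIQ for `r = 2`):
for `u` a nonzerodivisor of `A` and `v` a nonzerodivisor modulo `u`, the map `X ↦ v/u` induces a
ring isomorphism `A[X]/(uX - v) ≅ A[(u, v)/u]` over `A` (injective by
`BlowupChartPair.ker_chartEval`, surjective because `A[(u,v)/u]` is generated by `u/u = 1` and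
`v/u`). [cite: StacksProject, Tag 0BIQ] -/
theorem ringEquiv_quotient_blowupAlgebra_pair (u v : A) (hu : u ∈ nonZeroDivisors A)
    (huv : ∀ r : A, u ∣ r * v → u ∣ r) :
    ∃ θ : (A[X] ⧸ Ideal.span {C u * X - C v}) ≃+* blowupAlgebra (Ideal.span {u, v}) u,
      (∀ a, θ (Ideal.Quotient.mk _ (C a)) = algebraMap A _ a) ∧
      ((θ (Ideal.Quotient.mk _ X) : Localization.Away u) =
        algebraMap A (Localization.Away u) v * IsLocalization.Away.invSelf u) := by
  classical
  -- the map `A[X] → A[(u,v)/u]`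
  let ev : A[X] →+* blowupAlgebra (Ideal.span {u, v}) u :=
    { toFun := fun p ↦ ⟨_, eval₂_mem_blowupAlgebra_pair u v p⟩
      map_one' := Subtype.ext (by simp)
      map_mul' := fun p q ↦ Subtype.ext (by simp [Polynomial.eval₂_mul])
      map_zero' := Subtype.ext (by simp)
      map_add' := fun p q ↦ Subtype.ext (by simp [Polynomial.eval₂_add]) }
  have hev : ∀ p, ((ev p : blowupAlgebra _ u) : Localization.Away u) =
      BlowupChartPair.chartEval u v p := fun p ↦ (chartEval_eq_eval₂ u v p).symm
  have hker : RingHom.ker ev = Ideal.span {C u * X - C v} := by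
    rw [← BlowupChartPair.ker_chartEval u v hu huv]
    ext p
    rw [RingHom.mem_ker, RingHom.mem_ker]
    change ev p = 0 ↔ BlowupChartPair.chartEval u v p = 0
    rw [← hev]
    exact ⟨fun h ↦ by rw [h]; rfl, fun h ↦ Subtype.ext h⟩
  -- the induced map on the quotient
  let θ : (A[X] ⧸ Ideal.span {C u * X - C v}) →+* blowupAlgebra (Ideal.span {u, v}) u :=
    Ideal.Quotient.lift _ ev fun p hp ↦ by rwa [← RingHom.mem_ker, hker]
  have hinj : Function.Injective θ := by
    rw [RingHom.injective_iff_ker_eq_bot, RingHom.ker_eq_bot_iff_eq_zero]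
    intro p hp
    obtain ⟨p, rfl⟩ := Ideal.Quotient.mk_surjective p
    rw [Ideal.Quotient.eq_zero_iff_mem, ← hker, RingHom.mem_ker]
    exact hp
  have hsurj : Function.Surjective θ := by
    -- `A[(u,v)/u] ⊆ range (X ↦ v/u)`: the generators `x/u`, `x = a u + b v`, are `a + b · v/u`
    have hle : blowupAlgebra (Ideal.span {u, v}) u ≤ (BlowupChartPair.chartEval u v).range := by
      refine Algebra.adjoin_le ?_
      rintro _ ⟨x, hx, rfl⟩
      obtain ⟨a, b, rfl⟩ := Ideal.mem_span_pair.mp hx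
      refine ⟨C a + C b * X, ?_⟩
      change BlowupChartPair.chartEval u v (C a + C b * X) = _
      rw [chartEval_eq_eval₂, Polynomial.eval₂_add, Polynomial.eval₂_mul, Polynomial.eval₂_C,
        Polynomial.eval₂_C, Polynomial.eval₂_X, map_add, map_mul, map_mul, add_mul,
        mul_assoc, mul_assoc, IsLocalization.Away.mul_invSelf, mul_one]
    intro y
    obtain ⟨p, hp⟩ := hle y.2
    refine ⟨Ideal.Quotient.mk _ p, Subtype.ext ?_⟩
    change ((ev p : blowupAlgebra _ u) : Localization.Away u) = y
    rw [hev]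
    exact hp
  refine ⟨RingEquiv.ofBijective θ ⟨hinj, hsurj⟩, fun a ↦ ?_, ?_⟩
  · apply Subtype.ext
    change Polynomial.eval₂ _ _ (C a) = _
    rw [Polynomial.eval₂_C]
    rfl
  · change Polynomial.eval₂ _ _ X = _
    rw [Polynomial.eval₂_X]

/-- **Killing an ideal `K ⊇ (u, v)` in `A[X]/(uX - v)` gives `(A/K)[X]`**: the relation dies and
`A[X]/K A[X] = (A/K)[X]`; the isomorphism sends the class of `C a` to `C ā` and the class of `X`
to `X`. [folklore] -/
theorem exists_ringEquiv_quotQuot_pair (u v : A) (K : Ideal A) (hK : Ideal.span {u, v} ≤ K) :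
    ∃ ε : ((A[X] ⧸ Ideal.span {C u * X - C v}) ⧸
        K.map ((Ideal.Quotient.mk (Ideal.span {C u * X - C v})).comp C)) ≃+* (A ⧸ K)[X],
      (∀ a, ε (Ideal.Quotient.mk _ (Ideal.Quotient.mk _ (C a))) = C (Ideal.Quotient.mk K a)) ∧
      ε (Ideal.Quotient.mk _ (Ideal.Quotient.mk _ X)) = X := by
  have hu : u ∈ K := hK (Ideal.subset_span (by simp))
  have hv : v ∈ K := hK (Ideal.subset_span (by simp))
  set R : Ideal A[X] := Ideal.span {C u * X - C v} with hR
  -- `K (A[X]/R) = (K A[X]) · (A[X]/R)` and `R ⊔ K A[X] = K A[X]`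
  have hmap : K.map ((Ideal.Quotient.mk R).comp C) = (K.map C).map (Ideal.Quotient.mk R) :=
    (Ideal.map_map C (Ideal.Quotient.mk R)).symm
  have hsup : R ⊔ K.map (C : A →+* A[X]) = K.map C := by
    refine sup_eq_right.mpr ?_
    rw [hR, Ideal.span_le, Set.singleton_subset_iff]
    exact Ideal.sub_mem _ (Ideal.mul_mem_right _ _ (Ideal.mem_map_of_mem _ hu))
      (Ideal.mem_map_of_mem _ hv)
  let ε₁ : ((A[X] ⧸ R) ⧸ K.map ((Ideal.Quotient.mk R).comp C)) ≃+*
      ((A[X] ⧸ R) ⧸ (K.map C).map (Ideal.Quotient.mk R)) := Ideal.quotEquivOfEq hmap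
  let ε₂ : ((A[X] ⧸ R) ⧸ (K.map C).map (Ideal.Quotient.mk R)) ≃+* (A[X] ⧸ R ⊔ K.map C) :=
    DoubleQuot.quotQuotEquivQuotSup R (K.map C)
  let ε₃ : (A[X] ⧸ R ⊔ K.map C) ≃+* (A[X] ⧸ K.map C) := Ideal.quotEquivOfEq hsup
  let ε₄ : (A[X] ⧸ K.map C) ≃+* (A ⧸ K)[X] := (Ideal.polynomialQuotientEquivQuotientPolynomial K).symm
  have hε : ∀ p : A[X], (ε₁.trans (ε₂.trans (ε₃.trans ε₄)))
      (Ideal.Quotient.mk _ (Ideal.Quotient.mk R p)) = p.map (Ideal.Quotient.mk K) := fun p ↦ by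
    change ε₄ (ε₃ (ε₂ (ε₁ (Ideal.Quotient.mk _ (Ideal.Quotient.mk R p))))) = _
    have h1 : ε₁ (Ideal.Quotient.mk _ (Ideal.Quotient.mk R p)) =
        Ideal.Quotient.mk _ (Ideal.Quotient.mk R p) := rfl
    rw [h1]
    change ε₄ (ε₃ (DoubleQuot.quotQuotEquivQuotSup R (K.map C) (DoubleQuot.quotQuotMk R (K.map C) p))) = _
    rw [DoubleQuot.quotQuotEquivQuotSup_quotQuotMk]
    change ε₄ (Ideal.Quotient.mk _ p) = _
    exact Ideal.polynomialQuotientEquivQuotientPolynomial_symm_mk K p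
  refine ⟨ε₁.trans (ε₂.trans (ε₃.trans ε₄)), fun a ↦ ?_, ?_⟩
  · rw [hε, Polynomial.map_C]
  · rw [hε, Polynomial.map_X]

/-- **Transport of `exists_ringEquiv_quotQuot_pair` along a chart isomorphism**: for a ring `B`
over `A` (structure map `φ`) with `e : B ≅ A[X]/(uX - v)` over `A`, and an ideal `K ⊇ (u, v)`,
`B / K B ≅ (A/K)[X]` with `φ a ↦ ā` and `e⁻¹(X̄) ↦ X`. [folklore] -/
theorem exists_ringEquiv_quotient_of_ringEquiv_pair_algebra {B : Type*} [CommRing B]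
    (φ : A →+* B) (u v : A) (e : B ≃+* (A[X] ⧸ Ideal.span {C u * X - C v}))
    (he : ∀ a, e (φ a) = Ideal.Quotient.mk _ (C a)) (K : Ideal A) (hK : Ideal.span {u, v} ≤ K) :
    ∃ ε : (B ⧸ K.map φ) ≃+* (A ⧸ K)[X],
      (∀ a, ε (Ideal.Quotient.mk _ (φ a)) = C (Ideal.Quotient.mk K a)) ∧
      ε (Ideal.Quotient.mk _ (e.symm (Ideal.Quotient.mk _ X))) = X := by
  obtain ⟨ε, hεC, hεX⟩ := exists_ringEquiv_quotQuot_pair u v K hK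
  have hcomp : ((Ideal.Quotient.mk (Ideal.span {C u * X - C v})).comp C) = (e : B →+* _).comp φ :=
    RingHom.ext fun a ↦ (he a).symm
  have hmapK : K.map ((Ideal.Quotient.mk (Ideal.span {C u * X - C v})).comp C) =
      (K.map φ).map (e : B →+* _) := by
    rw [Ideal.map_map, hcomp]
  let e' := Ideal.quotientEquiv _ _ e hmapK
  have he' : ∀ x, e' (Ideal.Quotient.mk _ x) = Ideal.Quotient.mk _ (e x) := fun x ↦ rfl
  refine ⟨e'.trans ε, fun a ↦ ?_, ?_⟩
  · change ε (e' (Ideal.Quotient.mk _ _)) = _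
    rw [he', he]
    exact hεC a
  · change ε (e' (Ideal.Quotient.mk _ _)) = _
    rw [he', RingEquiv.apply_symm_apply]
    exact hεX

/-- **`A → B/(T)` is surjective** for `B ≅ A[X]/(uX - v)` over `A`, `T = e⁻¹(X̄)`: every `b ∈ B` is
`φ(a) + T · b'` (write a representative as `g = g(0) + X · g'`). [folklore] -/
theorem exists_sub_mem_span_of_ringEquiv_pair {B : Type*} [CommRing B]
    (φ : A →+* B) (u v : A) (e : B ≃+* (A[X] ⧸ Ideal.span {C u * X - C v}))
    (he : ∀ a, e (φ a) = Ideal.Quotient.mk _ (C a)) (b : B) :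
    ∃ a : A, b - φ a ∈ Ideal.span {e.symm (Ideal.Quotient.mk _ X)} := by
  obtain ⟨g, hg⟩ := Ideal.Quotient.mk_surjective (e b)
  refine ⟨g.coeff 0, Ideal.mem_span_singleton'.mpr ⟨e.symm (Ideal.Quotient.mk _ (divX g)), ?_⟩⟩
  apply e.injective
  rw [map_mul, RingEquiv.apply_symm_apply, RingEquiv.apply_symm_apply, map_sub, he, ← hg,
    ← map_mul, ← map_sub]
  congr 1
  rw [eq_sub_iff_add_eq, divX_mul_X_add]

/-- **Ideals of `B` containing `T` are determined by their contraction to `A`** (`B` as above):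
if `T ∈ P₁ ∩ P₂` and `φ⁻¹P₁ = φ⁻¹P₂` then `P₁ = P₂`. [folklore] -/
theorem ideal_eq_of_comap_eq_of_ringEquiv_pair {B : Type*} [CommRing B]
    (φ : A →+* B) (u v : A) (e : B ≃+* (A[X] ⧸ Ideal.span {C u * X - C v}))
    (he : ∀ a, e (φ a) = Ideal.Quotient.mk _ (C a)) {P₁ P₂ : Ideal B}
    (h₁ : e.symm (Ideal.Quotient.mk _ X) ∈ P₁) (h₂ : e.symm (Ideal.Quotient.mk _ X) ∈ P₂)
    (h : P₁.comap φ = P₂.comap φ) : P₁ = P₂ := by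
  have key : ∀ {Q₁ Q₂ : Ideal B}, e.symm (Ideal.Quotient.mk _ X) ∈ Q₁ →
      e.symm (Ideal.Quotient.mk _ X) ∈ Q₂ → Q₁.comap φ = Q₂.comap φ → Q₁ ≤ Q₂ := by
    intro Q₁ Q₂ hQ₁ hQ₂ hQ b hb
    obtain ⟨a, hab⟩ := exists_sub_mem_span_of_ringEquiv_pair φ u v e he b
    obtain ⟨t, ht⟩ := Ideal.mem_span_singleton'.mp hab
    have ha : φ a ∈ Q₁ := by
      have : φ a = b - t * e.symm (Ideal.Quotient.mk _ X) := by rw [ht]; ring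
      rw [this]
      exact Q₁.sub_mem hb (Q₁.mul_mem_left t hQ₁)
    have ha' : a ∈ Q₂.comap φ := hQ ▸ (Ideal.mem_comap.mpr ha)
    have hb' : b = φ a + t * e.symm (Ideal.Quotient.mk _ X) := by rw [ht]; ring
    rw [hb']
    exact Q₂.add_mem (Ideal.mem_comap.mp ha') (Q₂.mul_mem_left t hQ₂)
  exact le_antisymm (key h₁ h₂ h) (key h₂ h₁ h.symm)

end Algebra

/-! ## The chart `X'[W, u] ≅ Spec A[X]/(uX - v)` -/

section Charts

variable {X' X : Scheme.{u}} {π : X' ⟶ X} {I : X.IdealSheafData}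

/-- `{u, v}` is the range of the pair `![u, v]`. [folklore] -/
theorem range_vecCons_pair {R : Type*} (u v : R) : Set.range ![u, v] = {u, v} := by
  ext x
  simp only [Set.mem_range, Set.mem_insert_iff, Set.mem_singleton_iff]
  constructor
  · rintro ⟨i, rfl⟩
    fin_cases i <;> simp
  · rintro (rfl | rfl)
    · exact ⟨0, rfl⟩
    · exact ⟨1, rfl⟩

/-- **The two principal charts cover `π⁻¹(W)`** when `I(W) = (u, v)` (Stacks 0804).
[cite: StacksProject, Tag 0804] -/
theorem IsBlowup.blowupChart_sup_blowupChart_pair (hπ : IsBlowup π I) (W : X.affineOpens)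
    {u v : Γ(X, W)} (hI : I.ideal W = Ideal.span {u, v}) :
    blowupChart π I W u ⊔ blowupChart π I W v = π ⁻¹ᵁ (W : X.Opens) := by
  have h := hπ.iSup_blowupChart (U := W) ![u, v] (by rw [range_vecCons_pair, hI])
  rw [← h]
  apply le_antisymm
  · exact sup_le (le_iSup (fun k ↦ blowupChart π I W (![u, v] k)) 0)
      (le_iSup (fun k ↦ blowupChart π I W (![u, v] k)) 1)
  · refine iSup_le fun k ↦ ?_
    fin_cases k
    · exact le_sup_left
    · exact le_sup_right

/-- **The chart `X'[W, u]` of the blow-up along a regular pair is `Spec A[X]/(uX - v)` over `W`.**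
For a blowing up `π : X' → X` along `I`, an affine open `W` with `I(W) = (u, v)`, `u` a
nonzerodivisor of `A = Γ(X, W)` and `v` a nonzerodivisor modulo `u`: a ring isomorphism
`Γ(X', X'[W, u]) ≅ A[X]/(uX - v)` under which `π^* : A → Γ(X', X'[W, u])` becomes `a ↦ ā`
(`IsBlowup.exists_blowupAlgebra_chart_opensRange_eq`: the chart is `Spec A[(u,v)/u]`;
`ringEquiv_quotient_blowupAlgebra_pair`). [cite: StacksProject, Tag 0804 and Tag 0BIQ]
[cite: Fulton1998, proof of Lemma 2.4 (p. 37)] -/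
theorem IsBlowup.exists_ringEquiv_blowupChart_pair (hπ : IsBlowup π I) (W : X.affineOpens)
    {u v : Γ(X, W)} (hI : I.ideal W = Ideal.span {u, v}) (hu : u ∈ nonZeroDivisors Γ(X, W))
    (huv : ∀ r : Γ(X, W), u ∣ r * v → u ∣ r) :
    ∃ e : Γ(X', blowupChart π I W u) ≃+* ((Γ(X, W))[X] ⧸ Ideal.span {C u * Polynomial.X - C v}),
      ∀ s, e (π.appLE W (blowupChart π I W u) (blowupChart_le_preimage π I W u) s) =
        Ideal.Quotient.mk _ (C s) := by
  have huI : u ∈ I.ideal W := hI ▸ Ideal.subset_span (by simp)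
  obtain ⟨g, hg, hrange, hgπ⟩ := hπ.exists_blowupAlgebra_chart_opensRange_eq W u huI
  have hVU := image_top_le_preimage_of_comp_eq π g W _ hgπ
  have key := appLE_appIso_ΓSpecIso_of_comp_eq π g W _ hgπ hVU
  have htop : g ''ᵁ ⊤ = blowupChart π I W u := by
    rw [Scheme.Hom.image_top_eq_opensRange, hrange]
  obtain ⟨θ, hθC, -⟩ := ringEquiv_quotient_blowupAlgebra_pair u v hu huv
  have hIspan : blowupAlgebra (I.ideal W) u = blowupAlgebra (Ideal.span {u, v}) u := by rw [hI]
  -- `Γ(X', X'[W,u]) ≅ Γ(X', g(Spec)) ≅ Γ(Spec A[I/u], ⊤) ≅ A[I/u] = A[(u,v)/u] ≅ A[X]/(uX - v)`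
  let e₀ : Γ(X', blowupChart π I W u) ≅ Γ(X', g ''ᵁ ⊤) := X'.presheaf.mapIso (eqToIso htop).op
  let e₁ : Γ(X', blowupChart π I W u) ≃+* blowupAlgebra (I.ideal W) u :=
    (e₀ ≪≫ g.appIso ⊤ ≪≫ Scheme.ΓSpecIso _).commRingCatIsoToRingEquiv
  let e₂ : blowupAlgebra (I.ideal W) u ≃+* blowupAlgebra (Ideal.span {u, v}) u :=
    (Subalgebra.equivOfEq _ _ hIspan).toRingEquiv
  have he₀ : π.appLE W (blowupChart π I W u) (blowupChart_le_preimage π I W u) ≫ e₀.hom =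
      π.appLE W (g ''ᵁ ⊤) hVU := by
    change π.appLE W (blowupChart π I W u) _ ≫ X'.presheaf.map _ = _
    exact Scheme.Hom.appLE_map π _ _
  have he₁ : ∀ s, e₁ (π.appLE W (blowupChart π I W u) (blowupChart_le_preimage π I W u) s) =
      algebraMap Γ(X, W) (blowupAlgebra (I.ideal W) u) s := fun s ↦ by
    change ((π.appLE W (blowupChart π I W u) (blowupChart_le_preimage π I W u) ≫ e₀.hom) ≫
      (g.appIso ⊤).hom ≫ (Scheme.ΓSpecIso _).hom) s = _
    rw [he₀, key]
    rfl
  refine ⟨e₁.trans (e₂.trans θ.symm), fun s ↦ ?_⟩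
  change θ.symm (e₂ (e₁ _)) = _
  rw [he₁]
  apply θ.injective
  rw [RingEquiv.apply_symm_apply, hθC]
  rfl

/-- **The regular function `T = π^*v/π^*u` on the chart `X'[W, u]`**: under an isomorphism `e` as
in `IsBlowup.exists_ringEquiv_blowupChart_pair`, the element `T = e⁻¹(X̄)` satisfies
`π^*v = π^*u · T`. [cite: Fulton1998, proof of Lemma 2.4 (p. 37)] -/
theorem appLE_eq_mul_of_ringEquiv_blowupChart_pair (W : X.affineOpens) {u v : Γ(X, W)}
    {V : X'.Opens} (hV : V ≤ π ⁻¹ᵁ (W : X.Opens))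
    (e : Γ(X', V) ≃+* ((Γ(X, W))[X] ⧸ Ideal.span {C u * Polynomial.X - C v}))
    (he : ∀ s, e (π.appLE W V hV s) = Ideal.Quotient.mk _ (C s)) :
    π.appLE W V hV v = π.appLE W V hV u * e.symm (Ideal.Quotient.mk _ Polynomial.X) := by
  apply e.injective
  rw [map_mul, he, he, RingEquiv.apply_symm_apply, ← map_mul, Ideal.Quotient.eq]
  exact Ideal.mem_span_singleton.mpr ⟨-1, by ring⟩

/-- **The exceptional divisor over a regular-pair chart, and its base changes, are affine lines**
(Liu, Thm. 8.1.19 (b), chartwise): with `e : Γ(X', V) ≅ A[X]/(uX - v)` over `A = Γ(X, W)` as in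
`IsBlowup.exists_ringEquiv_blowupChart_pair` (`V = X'[W, u]`) and `T = e⁻¹(X̄)` (so that
`π^*v = π^*u · T`, `appLE_eq_mul_of_ringEquiv_blowupChart_pair`), for every ideal `K ⊇ (u, v)` of
`A` (e.g. `K = (u, v)` itself, cutting out the centre, or the ideal of a closed subscheme of the
centre) the quotient of `Γ(X', V)` by the extension of `K` is `(A/K)[X]`: `π^*a ↦ ā`, `T ↦ X`.
[cite: Liu2002, Thm. 8.1.19 (b)] [cite: Fulton1998, proof of Lemma 2.4 (p. 37)] -/
theorem exists_ringEquiv_quotient_of_ringEquiv_pair (W : X.affineOpens) {u v : Γ(X, W)}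
    {V : X'.Opens} (hV : V ≤ π ⁻¹ᵁ (W : X.Opens))
    (e : Γ(X', V) ≃+* ((Γ(X, W))[X] ⧸ Ideal.span {C u * Polynomial.X - C v}))
    (he : ∀ s, e (π.appLE W V hV s) = Ideal.Quotient.mk _ (C s))
    (K : Ideal Γ(X, W)) (hK : Ideal.span {u, v} ≤ K) :
    ∃ ε : (Γ(X', V) ⧸ K.map (π.appLE W V hV).hom) ≃+* (Γ(X, W) ⧸ K)[X],
      (∀ a, ε (Ideal.Quotient.mk _ (π.appLE W V hV a)) = C (Ideal.Quotient.mk K a)) ∧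
      ε (Ideal.Quotient.mk _ (e.symm (Ideal.Quotient.mk _ Polynomial.X))) = Polynomial.X :=
  exists_ringEquiv_quotient_of_ringEquiv_pair_algebra (π.appLE W V hV).hom u v e he K hK

/-! ## The overlap of the two charts, and injectivity of `π` on `X'[W, u] ∖ X'[W, v]` -/

/-- **`D(T) ⊆ X'[W, v]`**: on the locus of `X'[W, u]` where `T = π^*v/π^*u` is invertible,
`π^*v` is also a regular generator of `I·𝒪_{X'}`, so that locus is a principal chart for
`(W, v)` (Stacks 0804, the gluing of the charts `Spec A[I/u]`, `Spec A[I/v]` along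
`D(v/u) = D(u/v)`). [cite: StacksProject, Tag 0804] -/
theorem IsBlowup.basicOpen_le_blowupChart_pair (hπ : IsBlowup π I) (W : X.affineOpens)
    {u v : Γ(X, W)} (huI : u ∈ I.ideal W) {T : Γ(X', blowupChart π I W u)}
    (hT : π.appLE W _ (blowupChart_le_preimage π I W u) v =
      π.appLE W _ (blowupChart_le_preimage π I W u) u * T) :
    X'.basicOpen T ≤ blowupChart π I W v := by
  -- the affine open `B = D(T) ⊆ X'[W, u]`, a principal chart for `u`
  have hCu : IsAffineOpen (blowupChart π I W u) := hπ.isAffineOpen_blowupChart huI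
  have hB : IsAffineOpen (X'.basicOpen T) := hCu.basicOpen T
  have hle : X'.basicOpen T ≤ blowupChart π I W u := X'.basicOpen_le T
  have hPC : IsPrincipalChart π I W u ⟨X'.basicOpen T, hB⟩ :=
    (hπ.isPrincipalChart_blowupChart huI).of_le hle
  obtain ⟨h, hnzd, hideal⟩ := hPC
  -- on `B`, `π^*v = π^*u · T|_B` with `T|_B` a unit
  have hunit : IsUnit (X'.presheaf.map (homOfLE hle).op T) := RingedSpace.isUnit_res_basicOpen _ T
  have hv : π.appLE W (X'.basicOpen T) h v =
      π.appLE W (X'.basicOpen T) h u * X'.presheaf.map (homOfLE hle).op T := by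
    rw [← map_appLE_eq (blowupChart_le_preimage π I W u) hle v, hT, map_mul,
      map_appLE_eq (blowupChart_le_preimage π I W u) hle u]
  have hPCv : IsPrincipalChart π I W v ⟨X'.basicOpen T, hB⟩ := by
    refine ⟨h, ?_, ?_⟩
    · rw [hv]
      exact mul_mem_nonZeroDivisors.mpr ⟨hnzd, hunit.mem_nonZeroDivisors⟩
    · rw [hideal, hv, Ideal.span_singleton_mul_right_unit hunit]
  exact hPCv.le_blowupChart

/-- `T = π^*v/π^*u` is unique on `X'[W, u]` (`π^*u` is a nonzerodivisor there), so it is the image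
of `X̄` under any chart isomorphism `Γ(X', X'[W, u]) ≅ A[X]/(uX - v)` over `A`. [folklore] -/
theorem IsBlowup.eq_symm_mk_X_of_appLE_eq_mul (hπ : IsBlowup π I) (W : X.affineOpens)
    {u v : Γ(X, W)} (huI : u ∈ I.ideal W) {T : Γ(X', blowupChart π I W u)}
    (hT : π.appLE W _ (blowupChart_le_preimage π I W u) v =
      π.appLE W _ (blowupChart_le_preimage π I W u) u * T)
    (e : Γ(X', blowupChart π I W u) ≃+* ((Γ(X, W))[X] ⧸ Ideal.span {C u * Polynomial.X - C v}))
    (he : ∀ s, e (π.appLE W (blowupChart π I W u) (blowupChart_le_preimage π I W u) s) =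
      Ideal.Quotient.mk _ (C s)) :
    T = e.symm (Ideal.Quotient.mk _ Polynomial.X) := by
  obtain ⟨h, hnzd, -⟩ := hπ.isPrincipalChart_blowupChart huI
  have h2 := appLE_eq_mul_of_ringEquiv_blowupChart_pair W _ e he
  rw [hT] at h2
  exact (mul_cancel_left_mem_nonZeroDivisors hnzd).mp h2

/-- **`π` is injective on `X'[W, u] ∖ D(T) = X'[W, u] ∖ X'[W, v]`** (the strict transform of
`V(v)`, mapped isomorphically onto `V(v) ∩ W` by `π`; Fulton, proof of Lemma 2.4: "`C'` maps
isomorphically by `π` into a subscheme of `D'`"): two points of `X'[W, u]` outside `D(T)` with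
the same image under `π` coincide (the prime ideals of `Γ(X', X'[W, u]) ≅ A[X]/(uX - v)` containing
`T` are determined by their contractions to `A`, `A → Γ/(T)` being surjective).
[cite: Fulton1998, proof of Lemma 2.4 (p. 37)] -/
theorem IsBlowup.eq_of_notMem_basicOpen_pair (hπ : IsBlowup π I) (W : X.affineOpens)
    {u v : Γ(X, W)} (hI : I.ideal W = Ideal.span {u, v}) (hu : u ∈ nonZeroDivisors Γ(X, W))
    (huv : ∀ r : Γ(X, W), u ∣ r * v → u ∣ r) {T : Γ(X', blowupChart π I W u)}
    (hT : π.appLE W _ (blowupChart_le_preimage π I W u) v =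
      π.appLE W _ (blowupChart_le_preimage π I W u) u * T)
    {z₁ z₂ : X'} (hz₁ : z₁ ∈ blowupChart π I W u) (hz₂ : z₂ ∈ blowupChart π I W u)
    (hT₁ : z₁ ∉ X'.basicOpen T) (hT₂ : z₂ ∉ X'.basicOpen T) (h : π z₁ = π z₂) :
    z₁ = z₂ := by
  have huI : u ∈ I.ideal W := hI ▸ Ideal.subset_span (by simp)
  have hCu : IsAffineOpen (blowupChart π I W u) := hπ.isAffineOpen_blowupChart huI
  obtain ⟨e, he⟩ := hπ.exists_ringEquiv_blowupChart_pair W hI hu huv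
  have hTe := hπ.eq_symm_mk_X_of_appLE_eq_mul W huI hT e he
  -- the primes of the two points, both containing `T`, with the same contraction
  have hmem : ∀ {z : X'} (hz : z ∈ blowupChart π I W u), z ∉ X'.basicOpen T →
      T ∈ (hCu.primeIdealOf ⟨z, hz⟩).asIdeal := by
    intro z hz hzT
    letI := TopCat.Presheaf.algebra_section_stalk X'.presheaf (⟨z, hz⟩ : blowupChart π I W u)
    haveI := hCu.isLocalization_stalk ⟨z, hz⟩
    by_contra hT'
    apply hzT
    rw [X'.mem_basicOpen T z hz]
    have hu' := (IsLocalization.AtPrime.isUnit_to_map_iff (X'.presheaf.stalk z)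
      (hCu.primeIdealOf ⟨z, hz⟩).asIdeal T).mpr hT'
    exact hu'
  have hcomap : ∀ {z : X'} (hz : z ∈ blowupChart π I W u),
      (hCu.primeIdealOf ⟨z, hz⟩).asIdeal.comap
        (π.appLE W _ (blowupChart_le_preimage π I W u)).hom =
        (W.2.primeIdealOf ⟨π z, blowupChart_le_preimage π I W u hz⟩).asIdeal := fun hz ↦
    congrArg PrimeSpectrum.asIdeal (IsAffineOpen.comap_primeIdealOf_appLE (f := π) W W.2 _ hCu
      (blowupChart_le_preimage π I W u) hz)
  have hP : (hCu.primeIdealOf ⟨z₁, hz₁⟩).asIdeal = (hCu.primeIdealOf ⟨z₂, hz₂⟩).asIdeal := by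
    refine ideal_eq_of_comap_eq_of_ringEquiv_pair (π.appLE W _ (blowupChart_le_preimage π I W u)).hom
      u v e he (hTe ▸ hmem hz₁ hT₁) (hTe ▸ hmem hz₂ hT₂) ?_
    rw [hcomap hz₁, hcomap hz₂]
    congr 3
  have hP' : hCu.primeIdealOf ⟨z₁, hz₁⟩ = hCu.primeIdealOf ⟨z₂, hz₂⟩ := PrimeSpectrum.ext hP
  have := congrArg hCu.fromSpec hP'
  rwa [IsAffineOpen.fromSpec_primeIdealOf, IsAffineOpen.fromSpec_primeIdealOf] at this

/-! ## Lifts along which a generator vanishes miss its chart -/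

/-- **A lift through the blow-up along which `v` pulls back to `0` misses the chart `X'[W, v]`.**
Let `λ : Y → X'` be a morphism such that the inverse image ideal `(λ ≫ π)⁻¹ I · 𝒪_Y` is an
effective Cartier divisor (as for the lifts `IsBlowup.lift`) and `(λ ≫ π)^* v = 0` on
`(λ ≫ π)⁻¹ W`. Then no point of `Y` maps into `X'[W, v]`: there `I · 𝒪_{X'}` is generated by
`π^* v`, so `(λ ≫ π)⁻¹ I · 𝒪_Y` would be generated near the point by `0`, which is not a
nonzerodivisor of a non-zero ring (used for the section `Xʳₘ × X⁰ₘ → E` of Shioda–Katsura's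
exceptional divisor, Tôhoku Math. J. 31 (1979), Thm. 1.7: it lands in the `u`-charts).
[cite: ShiodaKatsura1979, §1 Thm. 1.7 and (1.6)] -/
theorem IsBlowup.notMem_blowupChart_of_app_eq_zero (hπ : IsBlowup π I) (W : X.affineOpens)
    {v : Γ(X, W)} (hvI : v ∈ I.ideal W) {Y : Scheme.{u}} (l : Y ⟶ X')
    (hcart : IsEffectiveCartier (I.comap (l ≫ π))) (hv0 : (l ≫ π).app W v = 0) (p : Y) :
    l p ∉ blowupChart π I W v := by
  intro hp
  have hCv : IsAffineOpen (blowupChart π I W v) := hπ.isAffineOpen_blowupChart hvI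
  obtain ⟨h₀, -, hideal⟩ := hπ.isPrincipalChart_blowupChart hvI
  -- an affine neighbourhood of `p` inside `λ⁻¹ X'[W, v]` on which `(λ ≫ π)⁻¹ I · 𝒪_Y = (f)`, `f` regular
  obtain ⟨O, hpO, f, hf, hfO⟩ := hcart p
  obtain ⟨O', hO', hpO', hle⟩ := exists_isAffineOpen_mem_and_subset (X := Y) (x := p)
    (U := (O : Y.Opens) ⊓ l ⁻¹ᵁ blowupChart π I W v) ⟨hpO, hp⟩
  have hO'O : O' ≤ (O : Y.Opens) := fun y hy ↦ (hle hy).1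
  have hO'C : O' ≤ l ⁻¹ᵁ blowupChart π I W v := fun y hy ↦ (hle hy).2
  have hf' := map_mem_nonZeroDivisors_of_le (U := ⟨O', hO'⟩) (V := O) hO'O hf
  have hideal' := ideal_eq_span_map_of_le (I.comap (l ≫ π)) (U := ⟨O', hO'⟩) (V := O) hO'O hfO
  -- but this ideal is also generated by `(λ ≫ π)^* v = 0`
  have hzero : (I.comap (l ≫ π)).ideal ⟨O', hO'⟩ = ⊥ := by
    rw [Scheme.IdealSheafData.comap_comp,
      ideal_comap_of_le l (I.comap π) ⟨blowupChart π I W v, hCv⟩ ⟨O', hO'⟩ hO'C, hideal,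
      Ideal.map_span, Set.image_singleton, Ideal.span_singleton_eq_bot, ← CommRingCat.comp_apply,
      Scheme.Hom.appLE_comp_appLE]
    change ((l ≫ π).app W ≫ Y.presheaf.map (homOfLE _).op) v = 0
    rw [CommRingCat.comp_apply, hv0, map_zero]
  rw [hzero, eq_comm, Ideal.span_singleton_eq_bot] at hideal'
  rw [hideal'] at hf'
  -- `0` is a nonzerodivisor only in the zero ring, but `Γ(Y, O')` maps to the local ring at `p`
  haveI : Nontrivial Γ(Y, O') := ⟨⟨1, 0, fun h10 ↦ one_ne_zero (α := Y.presheaf.stalk p) (by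
    rw [← map_one (Y.presheaf.germ O' p hpO').hom, h10, map_zero])⟩⟩
  exact zero_notMem_nonZeroDivisors hf'

end Charts

end Literature.AlgebraicGeometry.Resolution

end
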